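import Summits.Ventures.GridStability.Models.ClassicalSwingLurie

/-!
# GridStability/Models/WSCC9SplitLurie — model-1's classical model WITH transfer conductances AS lit-6's SPLIT Lur'e system (Pai (3.43)–(3.45), rational data) + the slab-certificate ROA sentence for «WSCC9-postB-SPdamp-h12»

Cell `gridfusion` (LADDER-GRIDFUSION G2.c lossy tier; lead g4 R-LOSSY-SLAB-ROW AMENDMENT 1
2026-08-27T06:58:44Z / 07:05:16Z: #35 kernel path of record = (c′) SPLIT presentation of lit-6's
`LossyMultimachineLurieForm.lean` §7 (p506847); «model-1 APPEND WSCC9.splitLurieSystem + bridge instance»),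
seat gridfusion-model-1.  Filed as a NEW small module rather than an append to `ClassicalSwingLurie.lean`
(384 lines; the 400-line lint would bounce the append) — same namespaces, nothing restated.

THE OBJECT (lit-6 07:03:42Z index map of record, verbatim semantics): for `d : RecastData n`,
`d.splitLurieSystem δˢ := d.toModel.toLitNode.toSplitLurie δˢ` — states `Fin (n+1) ⊕ Fin n` =
`(ω₀ − ω_s, …, ω_n − ω_s | σ₁, …, σ_n)`, `σ_a = (δ_{a+1} − δ₀) − (δˢ_{a+1} − δˢ₀)` (model-1's `lurieState`,
unchanged); channels `(Fin (n+1) × Fin (n+1)) ⊕ (Fin (n+1) × Fin (n+1))` = the `(n+1)²` SINE channels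
`inl (p,q)` then the `(n+1)²` COSINE channels `inr (p,q)` (diagonal ones null); weights `C_pq = E_pE_qB_pq`
/ `D_pq = E_pE_qG_pq` into the source machine `p`; `δ*_{inl (p,q)} = δˢ_p − δˢ_q`,
`δ*_{inr (p,q)} = δˢ_p − δˢ_q + π/2`; `A`, `B`, `C` RATIONAL in the typed data (the polar `Y_pq`, `θ_pq` of
the directed presentation `lurieSystem` do not appear).  MODELLED: as `WSCC9.postB_SPdamp` (MV-2 + MV-P +
MV-SPD + MV-ω + MV-h12; transfer conductances KEPT).

CONTENTS: generic `RecastData.splitLurieSystem`, the HYPOTHESIS-FREE bridge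
`RecastData.hasDerivWithinAt_lurieState_split` (every solution of `d.toModel` drives `lurieState` along
`(d.splitLurieSystem δˢ).field`; needs only the A1 data `EqData`, no `B > 0`), the packaged sentence
`RecastData.lossy_split_roa` (lit-6 `InternalNode.lurieState_tendsto_zero_of_slabCertificate` transported:
an exact `SlabCertificate` + per-channel sector facts on a slab `γ` + rank-one level ⇒ every solution from
`{slab, V ≤ c}` keeps it and has all `ω_i → 0` (deviation coordinates), `δ_p − δ₀ → δˢ_p − δˢ₀`), and the
instance «WSCC9-postB-SPdamp-h12»: `WSCC9.splitLurieSystem`, `WSCC9.hasDerivWithinAt_lurieState_split`,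
`WSCC9.lossy_split_roa` (conditional ONLY on the certificate facts, like `WSCC9.lurie_roa` p493501), and
the exact channel sines / cosines `WSCC9.sin_angleOf_sub / cos_angleOf_sub` (= `postB_SPdamp.sd / cd`,
rationals) that lyap-1's `hsec` consumes with `channel_sector_sin(_narrow)` / `channel_sector_cos`.
CERTIFIED: nothing beyond identities; the certificate is sos-2's object «WSCC9LOSSY-split-slab-g<γ>-rk-B»
once typed by lyap-1 (`Bench/WSCC9LossySlab{Data,Roa}`).  No sentence here says a grid is stable.
[cite: Pai1981, §3.6.3 eqs. (3.43)–(3.45); VuTuritsyn2017, §4.3 Theorem 1]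
-/

noncomputable section

open Real Set Filter Topology Finset
open Literature.MathematicalPhysics.PowerSystems
open Literature.MathematicalPhysics.PowerSystems.LyapunovFunctionFamily (SlabCertificate)

namespace Summit.Ventures.GridStability.Models

namespace RecastData

variable {n : ℕ} (d : RecastData n) {δs : Fin (n + 1) → ℝ}

/-- The SPLIT Lur'e system of the recast model at an equilibrium `δˢ`: lit-6's `toSplitLurie` of
`toModel.toLitNode` (sine and cosine channels, rational weights `C_pq`, `D_pq`).
[cite: Pai1981, §3.6.3 eqs. (3.43)–(3.45)] -/
def splitLurieSystem (δs : Fin (n + 1) → ℝ) :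
    LyapunovFunctionFamily.System (Fin (n + 1) ⊕ Fin n)
      ((Fin (n + 1) × Fin (n + 1)) ⊕ (Fin (n + 1) × Fin (n + 1))) :=
  d.toModel.toLitNode.toSplitLurie δs

/-- **THE BRIDGE (split presentation, chain rule).** Along EVERY solution `c` of `d.toModel` on `univ`
(transfer conductances kept, damping as typed), with A1 data `δˢ`, the Lur'e state `t ↦ lurieState δˢ (c t)`
solves `ẋ = (d.splitLurieSystem δˢ).field x` within every time set. [cite: Pai1981, §3.6.3 eq. (3.45)] -/
theorem hasDerivWithinAt_lurieState_split (hE : d.EqData δs) {c : ℝ → ClassicalSwing.State (n + 1)}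
    (hc : d.toModel.IsSolutionOn c univ) {s : Set ℝ} (t : ℝ) :
    HasDerivWithinAt (fun τ => d.lurieState δs (c τ))
      ((d.splitLurieSystem δs).field (d.lurieState δs (c t))) s t :=
  d.toModel.toLitNode.hasDerivWithinAt_lurieState_split
    ((d.toModel.toLitNode_isEquilibrium_iff δs).2 (d.isEquilibrium_of_eqData hE))
    (d.toModel.isSolutionAt_toLitNode hc t)

/-- **ROA of the recast classical model WITH transfer conductances from an exact SLAB certificate on the
split presentation** (lit-6 `InternalNode.lurieState_tendsto_zero_of_slabCertificate` transported through
`toModel.toLitNode`): A1 data `δˢ`, an exact `Λ : SlabCertificate (d.splitLurieSystem δˢ)`, per-channel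
sector facts on the slab `γ`, rank-one facts `s_k` and a level `c < γ_k²/s_k` ⇒ every solution of
`d.toModel` on `univ` whose initial Lur'e state is in `{slab γ, V ≤ c}` keeps it for all `t ≥ 0` and has
`lurieState → 0` (all speed deviations `→ 0`, all `δ_p − δ₀ → δˢ_p − δˢ₀`).  No observability hypothesis.
[cite: Pai1981, §2.16 Theorem [18], §3.6.3 eqs. (3.43)–(3.45); VuTuritsyn2017, §4.3 Theorem 1] -/
theorem lossy_split_roa (hE : d.EqData δs) (Λ : SlabCertificate (d.splitLurieSystem δs))
    {γ : (Fin (n + 1) × Fin (n + 1)) ⊕ (Fin (n + 1) × Fin (n + 1)) → ℝ}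
    (hsec : ∀ k ξ, |ξ - InternalNode.splitShift δs k| ≤ γ k → Λ.a k ≤ Real.cos ξ ∧ Real.cos ξ ≤ Λ.b k)
    {sk : (Fin (n + 1) × Fin (n + 1)) ⊕ (Fin (n + 1) × Fin (n + 1)) → ℝ} (hs0 : ∀ k, 0 < sk k)
    (hs : ∀ k, (sk k • Λ.P - Matrix.vecMulVec ((d.splitLurieSystem δs).C k)
      ((d.splitLurieSystem δs).C k)).PosSemidef)
    {lev : ℝ} (hlev : ∀ k, lev < γ k ^ 2 / sk k)
    {c : ℝ → ClassicalSwing.State (n + 1)} (hc : d.toModel.IsSolutionOn c univ)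
    (h0 : d.lurieState δs (c 0) ∈ (d.splitLurieSystem δs).slab γ)
    (h0c : Λ.V (d.lurieState δs (c 0)) ≤ lev) :
    (∀ t, 0 ≤ t → d.lurieState δs (c t) ∈ (d.splitLurieSystem δs).slab γ ∧
        Λ.V (d.lurieState δs (c t)) ≤ lev) ∧
      Tendsto (fun t => d.lurieState δs (c t)) atTop (𝓝 0) :=
  d.toModel.toLitNode.lurieState_tendsto_zero_of_slabCertificate
    ((d.toModel.toLitNode_isEquilibrium_iff δs).2 (d.isEquilibrium_of_eqData hE)) Λ hsec hs0 hs hlev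
    (fun t _ => d.toModel.isSolutionAt_toLitNode hc t) h0 h0c

end RecastData

/-! ### Instance of record «WSCC9-postB-SPdamp-h12» (transfer conductances KEPT), split presentation -/

namespace WSCC9

/-- The SPLIT Lur'e system of the instance of record at its A1 equilibrium (18 channels: 9 sine, 9 cosine;
the 6 diagonal ones null; rational `A`, `B`, `C`). [cite: Pai1981, §3.6.3 eq. (3.45)] -/
def splitLurieSystem :
    LyapunovFunctionFamily.System (Fin 3 ⊕ Fin 2) ((Fin 3 × Fin 3) ⊕ (Fin 3 × Fin 3)) :=
  postB_SPdamp.splitLurieSystem postB_SPdamp.angleOf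

/-- **HYPOTHESIS-FREE bridge for the instance of record (split presentation)**: every solution of
`WSCC9.postB_SPdamp.toModel` on `univ` drives the Lur'e state along `WSCC9.splitLurieSystem`. -/
theorem hasDerivWithinAt_lurieState_split {c : ℝ → ClassicalSwing.State 3}
    (hc : postB_SPdamp.toModel.IsSolutionOn c univ) {s : Set ℝ} (t : ℝ) :
    HasDerivWithinAt (fun τ => postB_SPdamp.lurieState postB_SPdamp.angleOf (c τ))
      (splitLurieSystem.field (postB_SPdamp.lurieState postB_SPdamp.angleOf (c t))) s t :=
  postB_SPdamp.hasDerivWithinAt_lurieState_split postB_SPdamp_eqData hc t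

/-- Exact channel sines: `sin(θ*_i − θ*_j) = sd i j` (rational) for the A1 equilibrium of record. -/
theorem sin_angleOf_sub (i j : Fin 3) :
    Real.sin (postB_SPdamp.angleOf i - postB_SPdamp.angleOf j) = (postB_SPdamp.sd i j : ℝ) :=
  (postB_SPdamp.sd_cast postB_SPdamp_eqData i j).symm

/-- Exact channel cosines: `cos(θ*_i − θ*_j) = cd i j` (rational). -/
theorem cos_angleOf_sub (i j : Fin 3) :
    Real.cos (postB_SPdamp.angleOf i - postB_SPdamp.angleOf j) = (postB_SPdamp.cd i j : ℝ) :=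
  (postB_SPdamp.cd_cast postB_SPdamp_eqData i j).symm

/-- **The lossy-tier ROA sentence for «WSCC9-postB-SPdamp-h12» on the SPLIT presentation, CONDITIONAL
ONLY ON THE CERTIFICATE** (#35 «G2.c-WSCC9-LOSSY-SLAB», path (c′)): for every exact
`Λ : SlabCertificate WSCC9.splitLurieSystem` with per-channel sector facts on a slab `γ` (from
`channel_sector_sin(_narrow)` / `channel_sector_cos` and `sin_angleOf_sub` / `cos_angleOf_sub`),
rank-one facts `s_k` and a level `lev < γ_k²/s_k`, EVERY solution of the printed post-B classical model
(transfer conductances kept, D/M = 1/10, 1/5, 3/10) starting in `{slab, V ≤ lev}` keeps it and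
synchronises: all `ω_i → 0`, `δ_m − δ_1 → θ*_m`.  MODELLED «WSCC9-postB-SPdamp-h12»; the certificate is
sos-2's re-emitted split object, typed by lyap-1. [cite: Pai1981, §3.6.3 eqs. (3.43)–(3.45); VuTuritsyn2017, §4.3 Theorem 1] -/
theorem lossy_split_roa (Λ : SlabCertificate splitLurieSystem)
    {γ : (Fin 3 × Fin 3) ⊕ (Fin 3 × Fin 3) → ℝ}
    (hsec : ∀ k ξ, |ξ - InternalNode.splitShift postB_SPdamp.angleOf k| ≤ γ k →
      Λ.a k ≤ Real.cos ξ ∧ Real.cos ξ ≤ Λ.b k)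
    {sk : (Fin 3 × Fin 3) ⊕ (Fin 3 × Fin 3) → ℝ} (hs0 : ∀ k, 0 < sk k)
    (hs : ∀ k, (sk k • Λ.P - Matrix.vecMulVec (splitLurieSystem.C k) (splitLurieSystem.C k)).PosSemidef)
    {lev : ℝ} (hlev : ∀ k, lev < γ k ^ 2 / sk k)
    {c : ℝ → ClassicalSwing.State 3} (hc : postB_SPdamp.toModel.IsSolutionOn c univ)
    (h0 : postB_SPdamp.lurieState postB_SPdamp.angleOf (c 0) ∈ splitLurieSystem.slab γ)
    (h0c : Λ.V (postB_SPdamp.lurieState postB_SPdamp.angleOf (c 0)) ≤ lev) :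
    (∀ t, 0 ≤ t → postB_SPdamp.lurieState postB_SPdamp.angleOf (c t) ∈ splitLurieSystem.slab γ ∧
        Λ.V (postB_SPdamp.lurieState postB_SPdamp.angleOf (c t)) ≤ lev) ∧
      Tendsto (fun t => postB_SPdamp.lurieState postB_SPdamp.angleOf (c t)) atTop (𝓝 0) :=
  postB_SPdamp.lossy_split_roa postB_SPdamp_eqData Λ hsec hs0 hs hlev hc h0 h0c

end WSCC9

end Summit.Ventures.GridStability.Models

end
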